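import Summits.BirchSwinnertonDyer.BirchSwinnertonDyer.Theses.GenusKolyvaginAtTwo
import Summits.BirchSwinnertonDyer.BirchSwinnertonDyer.Theorems.GenusKolyvaginAtTwoKolyvaginRelationAtTwoPair
import Summits.BirchSwinnertonDyer.BirchSwinnertonDyer.Theorems.GenusKolyvaginAtTwoKolyvaginRelationAtTwoLemma43
import Summits.BirchSwinnertonDyer.BirchSwinnertonDyer.Theorems.ErratumRoadFiveNonSurjCornerKolyJProp44StandingInputs
import Literature.NumberTheory.EllipticCurves.GrossLMS1991.HeegnerEulerSystemCongruenceInert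
import HarnessLib

/-!
# Route `GenusKolyvaginAtTwo`, LINE 6: Q2 `KolyvaginRelationAtTwo` (stmt-BirchSwinnertonDyer-24880) BY NAME,
# modulo ONE print fact — Gross 1991 Prop. 3.7 (2) = Nekovář 2007 Prop. 4.9 (the Eichler–Shimura
# congruence for Heegner points), `p`-free (seat gk2-p2 g7; CONDITIONAL closer)

Q2 = McCallum 1991 Prop. 4.4 «in particular» — `ord_λ d_M(mℓ) = ord_λ c_M(mℓ) = ord_λ c_M(m)` — with the
binders of the typed print fact `McCallum1991.prop44_localOrder_kolyvaginClass_mul_eq` VERBATIM and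
`p := 2`. This file proves IT — the route decl `Summit.….Theses.GenusKolyvaginAtTwo.KolyvaginRelationAtTwo`
— from ONE hypothesis: the tree's NAMED FACT `GrossLMS1991.prop37_2_reductionCongruence_inert` (Gross
Prop. 3.7 (2) / Nekovář Prop. 4.9 at one level pair, `p`-free, image-free; PUBLISHED, typed by the
Literature seats, unproved in the tree — the same input modulo which the odd-`p` fact is a kernel theorem,
bsd-stepL `Prop44.localOrder_kolyvaginClass_mul_eq_of_congruence_of_irr`), equivalently from Nekovář's
closed `Prop` `GrossLMS1991.prop37_2_frobeniusCongruence`. Every other input is a THEOREM: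
* the line's `p = 2` bet — no eigenspace / parity / Frobenius-class condition at `2` — is the seat's g5
  END `zsmul_kolyvaginClass_localOrders_of_heegnerInputs`, fed in concrete currency by
  `zsmul_kolyvaginClass_localOrders_of_compat_two` (`…KolyvaginRelationAtTwoPair`);
* McCallum's standing input `hA` (Gross Lemma 4.3: no `K[·]`-rational `2^M`-torsion) — FALSE at `2` in
  general, TRUE under Q2's binders: `isAdmissible_pointsSubgroup_two_of_heegner`
  (`…KolyvaginRelationAtTwoLemma43`: `ρ̄₂` onto, and Heegner + `d_K ≠ −4` force `K ≠ ℚ(√Δ_E)`);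
* `hPt` (Gross Prop. 3.6: `[P(·)]` is `Γ_K`-invariant mod `2^M`): bsd-stepL corner-p1's `p`-generic
  `Prop44.toGeomPoints_derivedPoint_mem_invPoints` (on the PROVED trace relation);
* the fact's side conditions: Zhang–Kolyvagin primes at `2` are odd (`zhangKolyvaginPrime_ne_two`), inert,
  prime to `N` and `d_K`.
HONEST FRAMING. `kolyvaginRelationAtTwo_of_prop37_2` / `…_of_frobeniusCongruence` are CONDITIONAL on a
named print fact (the gate's `conditional-result`); the `¬ W.HasCM` and `1 ≤ M` binders of Q2 are not used;
item 24880 closes only when (γ) is discharged in the tree. Nothing here is `2`-specific mathematics left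
open: Q2 at `2` is now EXACTLY as proved as McCallum's printed Prop. 4.4 at odd `p`. BSD is not proved by
any of this. References: [McCallumLMS1991] §4 Prop. 4.4 «in particular», (4)–(6), Lemma 4.3;
[GrossLMS1991] Prop. 3.6, 3.7 (1)(2), Lemma 4.3, Prop. 6.2; [Nekovar2007] Prop. 4.9; [WZhang2014] (xii).
-/

set_option autoImplicit false
set_option linter.dupNamespace false

noncomputable section

open scoped Classical

namespace Summit.BirchSwinnertonDyer.BirchSwinnertonDyer.Theorems.GenusExact

open WeierstrassCurve Field NumberField IsDedekindDomain Finset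
open Literature.NumberTheory.EllipticCurves Literature.NumberTheory.GaloisRepresentations
open Literature.NumberTheory.EllipticCurves.KolyvaginCocycle
open Literature.NumberTheory.EllipticCurves.RingClassField Literature.NumberTheory.EllipticCurves.ModularForms
open Literature.NumberTheory.EllipticCurves.GrossLMS1991
open Summit.BirchSwinnertonDyer.Rank1Residual.X11b
open Summit.BirchSwinnertonDyer.BirchSwinnertonDyer.Theses.GenusKolyvaginAtTwo

-- `K : Type`: the tree's ring-class class field theory is universe `0`.
variable {K : Type} [Field K] [NumberField K] {W : WeierstrassCurve ℚ}

/-! ## §1 (γ) for a compatible pair, from the named fact -/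

/-- **(γ) for the pair `(n, n/ℓ)` from the named fact `prop37_2_reductionCongruence_inert`**, in the binder
shape of `zsmul_kolyvaginClass_localOrders_of_compat_two` (data `d` at `n`, `d₀` at `m = n/ℓ`): an
unfolding of the fact at an ODD square-free level with inert prime factors prime to `N d_K`.
[cite: GrossLMS1991, Prop. 3.7 (2) (p. 240) (unfolding)] [cite: Nekovar2007, Prop. 4.9 (unfolding)] -/
theorem congruence_pair_of_prop37_2_inert {N : ℕ} [NeZero N] [W.IsGloballyMinimal] [W.IsElliptic]
    (h : prop37_2_reductionCongruence_inert N W K) (hN : N = W.conductorNorm ℤ)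
    (hK : IsImaginaryQuadratic K) (hD : NumberField.discr K ≠ -3 ∧ NumberField.discr K ≠ -4)
    (hH : SatisfiesHeegnerHypothesis N K) (Dt : ModularParametrizationData W N) (β : ℤ) (ι : K →+* ℂ)
    {n : ℕ} (hn : Squarefree n) (hodd : ∀ q ∈ n.primeFactors, q ≠ 2)
    (hinert : ∀ q ∈ n.primeFactors,
      ¬ q ∣ N ∧ ¬ ((q : ℤ) ∣ NumberField.discr K) ∧ (Ideal.span {(q : 𝓞 K)}).IsPrime)
    {ℓ : ℕ} (hℓ : ℓ ∈ n.primeFactors) {m : ℕ} (hmn : n / ℓ = m)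
    (d : KolyvaginHeegnerData Dt β ι n) (d₀ : KolyvaginHeegnerData Dt β ι m) :
    ∀ [Fact ℓ.Prime] (hΔ : ¬ (ℓ : ℤ) ∣ minimalDiscriminantInt W)
      (φ₀ : absoluteGaloisGroup (ZMod ℓ)), (∀ x : AlgebraicClosure (ZMod ℓ), φ₀ • x = x ^ ℓ) →
      ∀ (hle : ringClassField K ι m ≤ ringClassField K ι n)
        (γ : ringClassField K ι n ≃ₐ[ℚ] ringClassField K ι n), γ ∈ ringClassGal ι n →
        geomReduction hΔ ((RatClosure.pointsEquiv (K := K) W).symm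
            (d.toGeomPoints (pointGalHom W (ringClassField K ι n) γ d.y))) =
          φ₀ • geomReduction hΔ ((RatClosure.pointsEquiv (K := K) W).symm
            (d.toGeomPoints (pointGalHom W (ringClassField K ι n) γ
              (WeierstrassCurve.Affine.Point.map (W' := W)
                (letI : Algebra K ℂ := ι.toAlgebra; (RingClassField.inclusion ι hle).restrictScalars ℚ)
                d₀.y)))) := by
  subst hmn
  intro _ hΔ φ₀ hφ₀ hle γ hγ
  exact h.congruence hN hK hD hH Dt β ι hn (Or.inl hodd) hinert hℓ d d₀ hΔ hφ₀ hle hγ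

/-! ## §2 Q2's body for one pair, modulo (γ) — no standing input left -/

set_option maxHeartbeats 800000 in
/-- **McCallum Prop. 4.4 «in particular» AT `2` under EXACTLY Q2's binders, modulo (γ) for the pair**: for
`W/ℚ` globally minimal, `K` imaginary quadratic with `d_K ∉ {−3, −4}`, the Heegner hypothesis for `N_E`,
`ρ_{W,2^k}` onto for all `k`, a frame, `M`, compatible data `d` (level `m`), `d'` (level `mℓ`) at
Zhang–Kolyvagin levels at `2` of index `≥ M`, and (γ) for the pair: at `λ ∋ ℓ`, for every `j`,
(`2^j c_M(mℓ) ∈ Sel_λ ↔ 2^j c_M(mℓ)_λ = 0`) ∧ (`2^j c_M(mℓ)_λ = 0 ↔ 2^j c_M(m)_λ = 0`). `hA` by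
`isAdmissible_pointsSubgroup_two_of_heegner`, `hPt` by `Prop44.toGeomPoints_derivedPoint_mem_invPoints`.
[cite: McCallumLMS1991, §4 Prop. 4.4 «In particular» (p. 301), (4), (5)] [cite: GrossLMS1991, Prop. 3.6, 3.7 (2), Lemma 4.3] -/
theorem kolyvaginRelationAtTwo_pair_of_congruence [W.IsElliptic] [W.IsGloballyMinimal]
    [NeZero (W.conductorNorm ℤ)] (hK : IsImaginaryQuadratic K)
    (hD3 : NumberField.discr K ≠ -3) (hD4 : NumberField.discr K ≠ -4)
    (hH : SatisfiesHeegnerHypothesis (W.conductorNorm ℤ) K)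
    (hρ : ∀ n : ℕ, W.HasSurjectiveModNGaloisRep (2 ^ n : ℕ))
    (Dt : ModularParametrizationData W (W.conductorNorm ℤ)) (β : ℤ) (ι : K →+* ℂ) (M : ℕ)
    (m l : ℕ) (hsq : Squarefree (m * l)) (hl : l.Prime) (_hlm : ¬ l ∣ m)
    (hS : ∀ l' ∈ (m * l).primeFactors, Zhang2014.IsKolyvaginPrime (W.conductorNorm ℤ) W K 2 l' ∧
      M ≤ Zhang2014.kolyvaginIndex W 2 l')
    (d : KolyvaginHeegnerData Dt β ι m) (d' : KolyvaginHeegnerData Dt β ι (m * l))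
    (hσ : ∀ l' ∈ m.primeFactors, ∀ (x : ringClassField K ι m) (x' : ringClassField K ι (m * l)),
      (x : ℂ) = x' → ((d'.σ l' x' : ringClassField K ι (m * l)) : ℂ) = (d.σ l' x : ℂ))
    (hS₁ : ∀ s ∈ d.S, ∃ s' ∈ d'.S, ∀ (x : ringClassField K ι m) (x' : ringClassField K ι (m * l)),
      (x : ℂ) = x' → ((s' x' : ringClassField K ι (m * l)) : ℂ) = (s x : ℂ))
    (hS₂ : ∀ s' ∈ d'.S, ∃ s ∈ d.S, ∀ (x : ringClassField K ι m) (x' : ringClassField K ι (m * l)),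
      (x : ℂ) = x' → ((s' x' : ringClassField K ι (m * l)) : ℂ) = (s x : ℂ))
    (hemb : ∀ (x : ringClassField K ι m) (x' : ringClassField K ι (m * l)),
      (x : ℂ) = x' → d'.emb x' = d.emb x)
    (hγ : ∀ [Fact l.Prime] (hΔ : ¬ (l : ℤ) ∣ minimalDiscriminantInt W)
      (φ₀ : absoluteGaloisGroup (ZMod l)), (∀ x : AlgebraicClosure (ZMod l), φ₀ • x = x ^ l) →
      ∀ (hle : ringClassField K ι m ≤ ringClassField K ι (m * l))
        (γ : ringClassField K ι (m * l) ≃ₐ[ℚ] ringClassField K ι (m * l)), γ ∈ ringClassGal ι (m * l) →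
        geomReduction hΔ ((RatClosure.pointsEquiv (K := K) W).symm
            (d'.toGeomPoints (pointGalHom W (ringClassField K ι (m * l)) γ d'.y))) =
          φ₀ • geomReduction hΔ ((RatClosure.pointsEquiv (K := K) W).symm
            (d'.toGeomPoints (pointGalHom W (ringClassField K ι (m * l)) γ
              (WeierstrassCurve.Affine.Point.map (W' := W)
                (letI : Algebra K ℂ := ι.toAlgebra; (RingClassField.inclusion ι hle).restrictScalars ℚ)
                d.y)))))
    (v : HeightOneSpectrum (𝓞 K)) (hv : (l : 𝓞 K) ∈ v.asIdeal) (j : ℕ) :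
    ((((2 ^ j : ℕ) : ℤ) • d'.kolyvaginClass Nat.prime_two M ∈
          selmerLocalKer (W.baseChange K) (v.adicCompletion K) ((2 ^ M : ℕ) : ℤ) ↔
        ((2 ^ j : ℕ) : ℤ) • d'.kolyvaginClass Nat.prime_two M ∈
          (W.baseChange K).torsionLocalKer (v.adicCompletion K) ((2 ^ M : ℕ) : ℤ)) ∧
      (((2 ^ j : ℕ) : ℤ) • d'.kolyvaginClass Nat.prime_two M ∈
          (W.baseChange K).torsionLocalKer (v.adicCompletion K) ((2 ^ M : ℕ) : ℤ) ↔
        ((2 ^ j : ℕ) : ℤ) • d.kolyvaginClass Nat.prime_two M ∈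
          (W.baseChange K).torsionLocalKer (v.adicCompletion K) ((2 ^ M : ℕ) : ℤ))) := by
  have hD : NumberField.discr K < -4 := KolyvaginAssembly.discr_lt_neg_four hK ⟨hD3, hD4⟩
  have hn0 : m * l ≠ 0 := hsq.ne_zero
  have hm0 : m ≠ 0 := fun h ↦ hn0 (by rw [h, zero_mul])
  have hl' : l ∈ (m * l).primeFactors := Nat.mem_primeFactors.mpr ⟨hl, dvd_mul_left l m, hn0⟩
  have hmn : m * l / l = m := Nat.mul_div_cancel m hl.pos
  have hSm : ∀ q ∈ m.primeFactors, Zhang2014.IsKolyvaginPrime (W.conductorNorm ℤ) W K 2 q ∧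
      M ≤ Zhang2014.kolyvaginIndex W 2 q :=
    fun q hq ↦ hS q (Nat.primeFactors_mono (dvd_mul_right m l) hn0 hq)
  -- McCallum's standing inputs at the two levels: THEOREMS at `2` under Q2's binders
  have hA : IsAdmissible (absoluteGaloisGroup K) d.pointsSubgroup ((2 ^ M : ℕ) : ℤ) :=
    isAdmissible_pointsSubgroup_two_of_heegner d hK hm0 hD4 hH hρ M
  have hA' : IsAdmissible (absoluteGaloisGroup K) d'.pointsSubgroup ((2 ^ M : ℕ) : ℤ) :=
    isAdmissible_pointsSubgroup_two_of_heegner d' hK hn0 hD4 hH hρ M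
  have hPt := Prop44.toGeomPoints_derivedPoint_mem_invPoints hK ι hD hH Dt Nat.prime_two
    (hsq.squarefree_of_dvd (dvd_mul_right m l)) hSm d
  have hPt' := Prop44.toGeomPoints_derivedPoint_mem_invPoints hK ι hD hH Dt Nat.prime_two hsq hS d'
  exact zsmul_kolyvaginClass_localOrders_of_compat_two hK ι hD hH Dt hsq hS hl' hmn d' d hσ hS₁ hS₂
    hemb hγ hA' hA hPt' hPt v hv _

/-! ## §3 Q2 BY NAME, modulo the named fact -/

/-- **Q2 `KolyvaginRelationAtTwo` (stmt-BirchSwinnertonDyer-24880) from Gross 1991 Prop. 3.7 (2) at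
every `(W, K)`** — the tree's `p`-free, image-free named fact `prop37_2_reductionCongruence_inert`
(PUBLISHED: Gross LMS 153 p. 240; Nekovář LMS 320 Prop. 4.9), taken at `N = N_W` for all globally minimal
`W` and all `K`. CONDITIONAL on that print fact (nothing else); `¬CM` and `1 ≤ M` unused. The level `mℓ` is
odd (Zhang–Kolyvagin primes at `2` divide `ℓ' + 1` by `2`; `zhangKolyvaginPrime_ne_two`) and its prime
factors are inert and prime to `N_W d_K`, so the fact applies to the pair `(mℓ, m)`.
[cite: McCallumLMS1991, §4 Prop. 4.4 «In particular» (p. 301)] [cite: GrossLMS1991, Prop. 3.7 (2) (p. 240)]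
[cite: Nekovar2007, Prop. 4.9] -/
theorem kolyvaginRelationAtTwo_of_prop37_2
    (h37 : ∀ (W : WeierstrassCurve ℚ) [W.IsGloballyMinimal] [NeZero (W.conductorNorm ℤ)]
      (K : Type) [Field K] [NumberField K],
      prop37_2_reductionCongruence_inert (W.conductorNorm ℤ) W K) :
    KolyvaginRelationAtTwo := by
  intro W _ _ _ _ K _ _ hK hD3 hD4 hH hρ Dt β ι M _ m l hsq hl hlm hS d d' hσ hS₁ hS₂ hemb v hv j
  have hn0 : m * l ≠ 0 := hsq.ne_zero
  have hl' : l ∈ (m * l).primeFactors := Nat.mem_primeFactors.mpr ⟨hl, dvd_mul_left l m, hn0⟩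
  have hodd : ∀ q ∈ (m * l).primeFactors, q ≠ 2 := fun q hq ↦
    zhangKolyvaginPrime_ne_two Nat.prime_two (by norm_num) (hS q hq).1
  have hinert : ∀ q ∈ (m * l).primeFactors, ¬ q ∣ W.conductorNorm ℤ ∧
      ¬ ((q : ℤ) ∣ NumberField.discr K) ∧ (Ideal.span {(q : 𝓞 K)}).IsPrime :=
    fun q hq ↦ ⟨(hS q hq).1.2.1, (hS q hq).1.2.2.1, (hS q hq).1.2.2.2.2.1⟩
  exact kolyvaginRelationAtTwo_pair_of_congruence hK hD3 hD4 hH hρ Dt β ι M m l hsq hl hlm hS d d' hσ hS₁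
    hS₂ hemb (congruence_pair_of_prop37_2_inert (h37 W K) rfl hK ⟨hD3, hD4⟩ hH Dt β ι hsq hodd hinert hl'
      (Nat.mul_div_cancel m hl.pos) d' d) v hv j

/-- **Q2 `KolyvaginRelationAtTwo` from Nekovář's image-free congruence** `prop37_2_frobeniusCongruence` (one
closed `Prop`; LMS LN 320 Prop. 4.9 / Gross Prop. 3.7 (2)), via the tree's lattice road
`prop37_2_reductionCongruence_inert_of_frobeniusCongruence`. CONDITIONAL on that print fact.
[cite: Nekovar2007, Prop. 4.9] [cite: GrossLMS1991, Prop. 3.7 (2) (p. 240)] [cite: McCallumLMS1991, §4 Prop. 4.4] -/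
theorem kolyvaginRelationAtTwo_of_frobeniusCongruence (h : prop37_2_frobeniusCongruence) :
    KolyvaginRelationAtTwo :=
  kolyvaginRelationAtTwo_of_prop37_2 fun W _ _ K _ _ ↦
    prop37_2_reductionCongruence_inert_of_frobeniusCongruence h (W.conductorNorm ℤ) W K

end Summit.BirchSwinnertonDyer.BirchSwinnertonDyer.Theorems.GenusExact

end
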